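import Summits.QuantumFields.YangMills.Theorems.UnitScaleTiltProp7SmallFieldThm311
import Summits.QuantumFields.YangMills.Theorems.UnitScaleTiltProp7FlatActionExpansion
import Summits.QuantumFields.YangMills.Theorems.UnitScaleTiltAvgCurvGradWords
import HarnessLib

/-!
# Route `UnitScaleTilt`, crux K1 child «MinimiserStabilityRegPr» (stmt-QuantumFields-19200), registered stub `stub_prop7From14` (v4 828f5fb4a904d3be;
# leaf V3 «Prop 7 from a background (14)» = `T3Thm1CarrierNative.Prop7From14At`) — sub-lemma V3-B at a NON-FLAT background: THE PLAQUETTE VARIABLE OF A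
# COMPETITOR `U = W·U₀` AGAINST THE BACKGROUND PLAQUETTE IS `1 +` THE COVARIANT CURL `(D_{U₀}Y)(p)` OF THE FLUCTUATION `Y = UU₀^* − 1`, UP TO SECOND ORDER
# AND A CURVATURE TERM (exp-free chart, operator norms)

Cell `ym3-torus` ∕ fleet seat `ym-ust-19200-p1` (HUMAN RULING D-0037, YM ladder rung R3), successor g2.  WHERE THIS SITS.  [Balaban1985Variational] Sect. B
((22)–(31)) expands the Wilson action around a background `U₀` in the fluctuation `U′ = UU₀⁻¹ = exp(iηA)`: the plaquette of `U = U′U₀` is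
`(∂₀U′)((p)_z)·U₀(∂p)` with the fluctuations transported to the base point along the plaquette ([Balaban1985BackgroundPropagators] (3.1)–(3.2)), and its
linearisation is the covariant curl `(D_{U₀}A)(p)` of (3.4).  The predecessor seat landed the FLAT case `U₀ = 1` in the exp-free chart `Y = U − 1`
(`UnitScaleTiltProp7FlatActionExpansion.norm_plaq_sub_one_sub_lin_le`, `norm_plaqHol_sub_one_sub_curl_le`); THIS FILE is the same at an ARBITRARY `SU(N)`
background: with `Y(b) = U(b)U₀(b)^* − 1`,
`‖U(∂p)U₀(∂p)^* − 1 − (D_{U₀}Y)(p)‖ ≤ 2(Σ_{b∈∂p}‖Y(b)‖)² + 2‖U₀(∂p) − 1‖(‖Y(b₃)‖ + ‖Y(b₄)‖)`,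
where `(D_{U₀}Y)(p_{μν}(x)) = Y(x,μ) + U₀(x,μ)Y(x+e_μ,ν)U₀(x,μ)^* − U₀(x,ν)Y(x+e_ν,μ)U₀(x,ν)^* − Y(x,ν)` IS the tree's `B9Eq39Adjoint.curl` at the background
(`curl_bg_eq`) — the object whose `L²` form the seat's `UnitScaleTiltProp7SmallFieldThm311` bounds below on the covariant slice.  Together they are the two
inputs of the non-flat local-minimality model (141)–(143) (the flat model is `UnitScaleTiltProp7FlatLocalMinimality`).

WHAT IS PROVED (sorry-free, no definition; our own statements — [folklore] ∕ cited to the printed step they instantiate):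
* §1 `plaq_mul_background` — the group identity `(W₁V₁)(W₂V₂)(W₃V₃)⁻¹(W₄V₄)⁻¹ = [W₁·V₁W₂V₁⁻¹·(QW₃Q⁻¹)⁻¹·(P₀W₄P₀⁻¹)⁻¹]·P₀` (`Q = V₁V₂V₃⁻¹`,
  `P₀ = V₁V₂V₃⁻¹V₄⁻¹`); `norm_conj_sub_self_le'` (`‖PXP^* − X‖ ≤ 2‖P − 1‖‖X‖`); **`norm_plaq_mul_star_bg_sub_one_sub_lin_le`** — the flat second-order
  expansion applied to the transported fluctuations (EXACT linear part `Y₁ + V₁Y₂V₁^* − QY₃Q^* − P₀Y₄P₀^*`, remainder `≤ 2(Σ‖Y_i‖)²`); and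
  **`norm_plaq_mul_star_bg_sub_one_sub_curl_le`** — with the covariant-curl linear part `Y₁ + V₁Y₂V₁^* − V₄Y₃V₄^* − Y₄` (extra `2‖P₀ − 1‖(‖Y₃‖ + ‖Y₄‖)`).
* §2 on the lattice (`SU(N)` configurations `U`, `U₀` on `T^{(j)}`, `Setup`'s `GaugeField.plaqHol`): **`norm_plaqHol_mul_star_bg_sub_one_sub_covCurl_le`** (the
  display above) and **`curl_bg_eq`** — the linear part is `B9Eq39Adjoint.curl (torusT P j) (κ,z ↦ U₀(z,z+e_κ)) (κ,z ↦ Y(z,κ))` read through `unitsField ∘ toUField`.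

WHAT THIS IS NOT.  The action-level expansion at a background (the `SU(2)` Wilson action in Hilbert–Schmidt form, `A(U) − A(U₀) = ⟨J(U₀), Y⟩ + ¼Σ‖D_{U₀}Y‖²_HS
+ …`, print's (26)–(31)) and its composition with the small-field Thm 3.11 into the non-flat local-minimality model are the next files of the line; print's
exponential chart `U′ = exp(iηA)` and the bound (28) on the current `J` via [Balaban1985RegularSpaces] Sect. F are not modelled.  Nothing of Bałaban's is asserted.

References: T. Bałaban, CMP 102 (1985) 277–309 [Balaban1985Variational] ((22)–(31) pp.281–283); CMP 99 (1985) 389–434 [Balaban1985BackgroundPropagators]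
((3.1)–(3.4) pp.390–391); CMP 98 (1985) 17–51 [Balaban1985Averaging] ((9) p.19, (19)–(20) p.21).
-/

noncomputable section

open scoped BigOperators Matrix.Norms.L2Operator Matrix

namespace Summit.QuantumFields.YangMills.Theorems.Prop7CovariantCoercivity

open Literature.MathematicalPhysics.QuantumFieldTheory.Balaban1983to89
open Finset B1RG242Torus
open B9Eq39Adjoint (R R_def covD curl)
open B10Eq27TorusAxialLog (unitsField toUField unitsField_mem_unitaryUnits val_unitsField)
open B9TorusCalculus (torusT torusT_apply)
open Summit.QuantumFields.YangMills.Theorems.Prop7FlatExpansion (norm_plaq_sub_one_sub_lin_le coe_plaqHol)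
open Summit.QuantumFields.YangMills.Theorems.AvgCurvGrad (norm_coe_su norm_coe_conj_sub_conj)

variable {n : Type*} [Fintype n] [DecidableEq n]

/-! ## §1 The plaquette of a product configuration: group identity and the second-order expansion at a background -/

section Algebra

/-- **THE PLAQUETTE OF `U = W·U₀` FACTORS THROUGH THE BACKGROUND PLAQUETTE**: with `Q = V₁V₂V₃⁻¹`, `P₀ = V₁V₂V₃⁻¹V₄⁻¹`,
`(W₁V₁)(W₂V₂)(W₃V₃)⁻¹(W₄V₄)⁻¹ = [W₁ · V₁W₂V₁⁻¹ · (QW₃Q⁻¹)⁻¹ · (P₀W₄P₀⁻¹)⁻¹] · P₀` — the fluctuations transported to the base point along the plaquette.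
[cite: Balaban1985BackgroundPropagators, (3.1)-(3.2) p.390] -/
theorem plaq_mul_background {G : Type*} [Group G] (W₁ W₂ W₃ W₄ V₁ V₂ V₃ V₄ : G) :
    (W₁ * V₁) * (W₂ * V₂) * (W₃ * V₃)⁻¹ * (W₄ * V₄)⁻¹
      = (W₁ * (V₁ * W₂ * V₁⁻¹) * ((V₁ * V₂ * V₃⁻¹) * W₃ * (V₁ * V₂ * V₃⁻¹)⁻¹)⁻¹
          * ((V₁ * V₂ * V₃⁻¹ * V₄⁻¹) * W₄ * (V₁ * V₂ * V₃⁻¹ * V₄⁻¹)⁻¹)⁻¹) * (V₁ * V₂ * V₃⁻¹ * V₄⁻¹) := by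
  group

/-- Conjugation moves through `· − 1`: `gWg⁻¹ − 1 = g(W − 1)g⁻¹` in `M_n(ℂ)`, and its norm is `‖W − 1‖`. [folklore] -/
theorem norm_coe_conj_sub_one (g W : Matrix.specialUnitaryGroup n ℂ) :
    ‖((g * W * g⁻¹ : Matrix.specialUnitaryGroup n ℂ) : Matrix n n ℂ) - 1‖ = ‖(W : Matrix n n ℂ) - 1‖ := by
  have h := norm_coe_conj_sub_conj g W 1
  simpa using h

/-- `gWg⁻¹ − 1 = g(W − 1)g^*` read in `M_n(ℂ)`. [folklore] -/
theorem coe_conj_sub_one (g W : Matrix.specialUnitaryGroup n ℂ) :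
    ((g * W * g⁻¹ : Matrix.specialUnitaryGroup n ℂ) : Matrix n n ℂ) - 1 = (g : Matrix n n ℂ) * ((W : Matrix n n ℂ) - 1) * star (g : Matrix n n ℂ) := by
  have hg : (g : Matrix n n ℂ) * star (g : Matrix n n ℂ) = 1 := Matrix.mem_unitaryGroup_iff.mp g.2.1
  simp only [Submonoid.coe_mul]
  rw [show ((g⁻¹ : Matrix.specialUnitaryGroup n ℂ) : Matrix n n ℂ) = star (g : Matrix n n ℂ) from rfl, mul_sub, sub_mul, mul_one, hg]

/-- `‖PXP^* − X‖ ≤ 2‖P − 1‖‖X‖` for special unitary `P`. [folklore] -/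
theorem norm_conj_sub_self_le' (P : Matrix.specialUnitaryGroup n ℂ) (X : Matrix n n ℂ) :
    ‖(P : Matrix n n ℂ) * X * star (P : Matrix n n ℂ) - X‖ ≤ 2 * ‖(P : Matrix n n ℂ) - 1‖ * ‖X‖ := by
  have hP : (P : Matrix n n ℂ) ∈ Matrix.unitaryGroup n ℂ := P.2.1
  have hPs : star (P : Matrix n n ℂ) ∈ Matrix.unitaryGroup n ℂ := Unitary.star_mem hP
  have e : (P : Matrix n n ℂ) * X * star (P : Matrix n n ℂ) - X
      = ((P : Matrix n n ℂ) - 1) * X * star (P : Matrix n n ℂ) + X * (star (P : Matrix n n ℂ) - 1) := by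
    noncomm_ring
  rw [e]
  have n1 : ‖((P : Matrix n n ℂ) - 1) * X * star (P : Matrix n n ℂ)‖ ≤ ‖(P : Matrix n n ℂ) - 1‖ * ‖X‖ := by
    rw [CStarRing.norm_mul_mem_unitary _ hPs]; exact norm_mul_le _ _
  have n2 : ‖X * (star (P : Matrix n n ℂ) - 1)‖ ≤ ‖X‖ * ‖(P : Matrix n n ℂ) - 1‖ := by
    refine (norm_mul_le _ _).trans (le_of_eq ?_)
    rw [← norm_star (star (P : Matrix n n ℂ) - 1), star_sub, star_star, star_one]
  calc _ ≤ _ := norm_add_le _ _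
    _ ≤ ‖(P : Matrix n n ℂ) - 1‖ * ‖X‖ + ‖X‖ * ‖(P : Matrix n n ℂ) - 1‖ := add_le_add n1 n2
    _ = _ := by ring

/-- **[Balaban1985Variational] SECT. B AT A BACKGROUND, PER PLAQUETTE, EXACT LINEAR PART**: for special unitaries `W_i` (fluctuations, `Y_i = W_i − 1`,
`‖Y₁‖, ‖Y₃‖ ≤ 1`) and `V_i` (background links) with `P₀ = V₁V₂V₃⁻¹V₄⁻¹`, `Q = V₁V₂V₃⁻¹`:
`‖(W₁V₁)(W₂V₂)(W₃V₃)⁻¹(W₄V₄)⁻¹·P₀^* − 1 − (Y₁ + V₁Y₂V₁^* − QY₃Q^* − P₀Y₄P₀^*)‖ ≤ 2(Σ_i‖Y_i‖)²` — the flat expansion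
(`Prop7FlatExpansion.norm_plaq_sub_one_sub_lin_le`) applied to the transported fluctuations. [cite: Balaban1985Variational, (22)-(26) pp.281-282] -/
theorem norm_plaq_mul_star_bg_sub_one_sub_lin_le (W₁ W₂ W₃ W₄ V₁ V₂ V₃ V₄ : Matrix.specialUnitaryGroup n ℂ)
    (h₁ : ‖(W₁ : Matrix n n ℂ) - 1‖ ≤ 1) (h₃ : ‖(W₃ : Matrix n n ℂ) - 1‖ ≤ 1) :
    ‖(((W₁ * V₁) * (W₂ * V₂) * (W₃ * V₃)⁻¹ * (W₄ * V₄)⁻¹ : Matrix.specialUnitaryGroup n ℂ) : Matrix n n ℂ)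
          * star ((V₁ * V₂ * V₃⁻¹ * V₄⁻¹ : Matrix.specialUnitaryGroup n ℂ) : Matrix n n ℂ) - 1
        - (((W₁ : Matrix n n ℂ) - 1)
            + (V₁ : Matrix n n ℂ) * ((W₂ : Matrix n n ℂ) - 1) * star (V₁ : Matrix n n ℂ)
            - ((V₁ * V₂ * V₃⁻¹ : Matrix.specialUnitaryGroup n ℂ) : Matrix n n ℂ) * ((W₃ : Matrix n n ℂ) - 1)
                * star ((V₁ * V₂ * V₃⁻¹ : Matrix.specialUnitaryGroup n ℂ) : Matrix n n ℂ)
            - ((V₁ * V₂ * V₃⁻¹ * V₄⁻¹ : Matrix.specialUnitaryGroup n ℂ) : Matrix n n ℂ) * ((W₄ : Matrix n n ℂ) - 1)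
                * star ((V₁ * V₂ * V₃⁻¹ * V₄⁻¹ : Matrix.specialUnitaryGroup n ℂ) : Matrix n n ℂ))‖
      ≤ 2 * (‖(W₁ : Matrix n n ℂ) - 1‖ + ‖(W₂ : Matrix n n ℂ) - 1‖ + ‖(W₃ : Matrix n n ℂ) - 1‖ + ‖(W₄ : Matrix n n ℂ) - 1‖) ^ 2 := by
  set Q : Matrix.specialUnitaryGroup n ℂ := V₁ * V₂ * V₃⁻¹ with hQ
  set P₀ : Matrix.specialUnitaryGroup n ℂ := V₁ * V₂ * V₃⁻¹ * V₄⁻¹ with hP₀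
  set U₂ : Matrix.specialUnitaryGroup n ℂ := V₁ * W₂ * V₁⁻¹ with hU₂
  set U₃ : Matrix.specialUnitaryGroup n ℂ := Q * W₃ * Q⁻¹ with hU₃
  set U₄ : Matrix.specialUnitaryGroup n ℂ := P₀ * W₄ * P₀⁻¹ with hU₄
  -- the group identity, then multiply by `P₀⁻¹ = P₀^*`
  have hgrp : (W₁ * V₁) * (W₂ * V₂) * (W₃ * V₃)⁻¹ * (W₄ * V₄)⁻¹ = (W₁ * U₂ * U₃⁻¹ * U₄⁻¹) * P₀ := by
    rw [hU₂, hU₃, hU₄, hQ, hP₀]; exact plaq_mul_background W₁ W₂ W₃ W₄ V₁ V₂ V₃ V₄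
  have hmat : (((W₁ * V₁) * (W₂ * V₂) * (W₃ * V₃)⁻¹ * (W₄ * V₄)⁻¹ : Matrix.specialUnitaryGroup n ℂ) : Matrix n n ℂ) * star (P₀ : Matrix n n ℂ)
      = (W₁ : Matrix n n ℂ) * (U₂ : Matrix n n ℂ) * star (U₃ : Matrix n n ℂ) * star (U₄ : Matrix n n ℂ) := by
    rw [hgrp]
    have hP : (P₀ : Matrix n n ℂ) * star (P₀ : Matrix n n ℂ) = 1 := Matrix.mem_unitaryGroup_iff.mp P₀.2.1
    simp only [Submonoid.coe_mul]
    rw [show ((U₃⁻¹ : Matrix.specialUnitaryGroup n ℂ) : Matrix n n ℂ) = star (U₃ : Matrix n n ℂ) from rfl,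
      show ((U₄⁻¹ : Matrix.specialUnitaryGroup n ℂ) : Matrix n n ℂ) = star (U₄ : Matrix n n ℂ) from rfl, mul_assoc _ (P₀ : Matrix n n ℂ), hP, mul_one]
  rw [hmat]
  -- the transported fluctuations
  have e₂ : (V₁ : Matrix n n ℂ) * ((W₂ : Matrix n n ℂ) - 1) * star (V₁ : Matrix n n ℂ) = (U₂ : Matrix n n ℂ) - 1 := (coe_conj_sub_one V₁ W₂).symm
  have e₃ : (Q : Matrix n n ℂ) * ((W₃ : Matrix n n ℂ) - 1) * star (Q : Matrix n n ℂ) = (U₃ : Matrix n n ℂ) - 1 := (coe_conj_sub_one Q W₃).symm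
  have e₄ : (P₀ : Matrix n n ℂ) * ((W₄ : Matrix n n ℂ) - 1) * star (P₀ : Matrix n n ℂ) = (U₄ : Matrix n n ℂ) - 1 := (coe_conj_sub_one P₀ W₄).symm
  rw [e₂, e₃, e₄]
  have n₂ : ‖(U₂ : Matrix n n ℂ) - 1‖ = ‖(W₂ : Matrix n n ℂ) - 1‖ := norm_coe_conj_sub_one V₁ W₂
  have n₃ : ‖(U₃ : Matrix n n ℂ) - 1‖ = ‖(W₃ : Matrix n n ℂ) - 1‖ := norm_coe_conj_sub_one Q W₃
  have n₄ : ‖(U₄ : Matrix n n ℂ) - 1‖ = ‖(W₄ : Matrix n n ℂ) - 1‖ := norm_coe_conj_sub_one P₀ W₄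
  have h := norm_plaq_sub_one_sub_lin_le (U₁ := (W₁ : Matrix n n ℂ)) (U₂ := (U₂ : Matrix n n ℂ)) U₃.2.1 U₄.2.1 h₁ (by rw [n₃]; exact h₃)
  rw [n₂, n₃, n₄] at h
  exact h

/-- **THE COVARIANT CURL FORM**: replacing the transports `Q = P₀V₄` and `P₀` of the exact linear part by `V₄` and `1` costs `2‖P₀ − 1‖(‖Y₃‖ + ‖Y₄‖)`:
`‖(W·V)(∂p)·P₀^* − 1 − (Y₁ + V₁Y₂V₁^* − V₄Y₃V₄^* − Y₄)‖ ≤ 2(Σ‖Y_i‖)² + 2‖P₀ − 1‖(‖Y₃‖ + ‖Y₄‖)` — the plaquette of `U = WU₀` relative to the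
background plaquette is `1 +` the COVARIANT CURL `(D_{U₀}Y)(p)` of [Balaban1985BackgroundPropagators] (3.4) up to second order and a curvature term.
[cite: Balaban1985Variational, (22)-(26) pp.281-282; Balaban1985BackgroundPropagators, (3.4) p.391] -/
theorem norm_plaq_mul_star_bg_sub_one_sub_curl_le (W₁ W₂ W₃ W₄ V₁ V₂ V₃ V₄ : Matrix.specialUnitaryGroup n ℂ)
    (h₁ : ‖(W₁ : Matrix n n ℂ) - 1‖ ≤ 1) (h₃ : ‖(W₃ : Matrix n n ℂ) - 1‖ ≤ 1) :
    ‖(((W₁ * V₁) * (W₂ * V₂) * (W₃ * V₃)⁻¹ * (W₄ * V₄)⁻¹ : Matrix.specialUnitaryGroup n ℂ) : Matrix n n ℂ)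
          * star ((V₁ * V₂ * V₃⁻¹ * V₄⁻¹ : Matrix.specialUnitaryGroup n ℂ) : Matrix n n ℂ) - 1
        - (((W₁ : Matrix n n ℂ) - 1)
            + (V₁ : Matrix n n ℂ) * ((W₂ : Matrix n n ℂ) - 1) * star (V₁ : Matrix n n ℂ)
            - (V₄ : Matrix n n ℂ) * ((W₃ : Matrix n n ℂ) - 1) * star (V₄ : Matrix n n ℂ)
            - ((W₄ : Matrix n n ℂ) - 1))‖
      ≤ 2 * (‖(W₁ : Matrix n n ℂ) - 1‖ + ‖(W₂ : Matrix n n ℂ) - 1‖ + ‖(W₃ : Matrix n n ℂ) - 1‖ + ‖(W₄ : Matrix n n ℂ) - 1‖) ^ 2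
        + 2 * ‖((V₁ * V₂ * V₃⁻¹ * V₄⁻¹ : Matrix.specialUnitaryGroup n ℂ) : Matrix n n ℂ) - 1‖
            * (‖(W₃ : Matrix n n ℂ) - 1‖ + ‖(W₄ : Matrix n n ℂ) - 1‖) := by
  have hmain := norm_plaq_mul_star_bg_sub_one_sub_lin_le W₁ W₂ W₃ W₄ V₁ V₂ V₃ V₄ h₁ h₃
  set P₀ : Matrix.specialUnitaryGroup n ℂ := V₁ * V₂ * V₃⁻¹ * V₄⁻¹ with hP₀
  -- `Q = P₀ V₄`
  have hQ : (V₁ * V₂ * V₃⁻¹ : Matrix.specialUnitaryGroup n ℂ) = P₀ * V₄ := by rw [hP₀]; group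
  -- the two replacements
  have r₃ : ‖((V₁ * V₂ * V₃⁻¹ : Matrix.specialUnitaryGroup n ℂ) : Matrix n n ℂ) * ((W₃ : Matrix n n ℂ) - 1)
        * star ((V₁ * V₂ * V₃⁻¹ : Matrix.specialUnitaryGroup n ℂ) : Matrix n n ℂ)
        - (V₄ : Matrix n n ℂ) * ((W₃ : Matrix n n ℂ) - 1) * star (V₄ : Matrix n n ℂ)‖
      ≤ 2 * ‖(P₀ : Matrix n n ℂ) - 1‖ * ‖(W₃ : Matrix n n ℂ) - 1‖ := by
    rw [hQ, Submonoid.coe_mul, star_mul]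
    have e : (P₀ : Matrix n n ℂ) * (V₄ : Matrix n n ℂ) * ((W₃ : Matrix n n ℂ) - 1) * (star (V₄ : Matrix n n ℂ) * star (P₀ : Matrix n n ℂ))
        = (P₀ : Matrix n n ℂ) * ((V₄ : Matrix n n ℂ) * ((W₃ : Matrix n n ℂ) - 1) * star (V₄ : Matrix n n ℂ)) * star (P₀ : Matrix n n ℂ) := by
      noncomm_ring
    rw [e]
    refine (norm_conj_sub_self_le' P₀ _).trans (le_of_eq ?_)
    have hV : (V₄ : Matrix n n ℂ) ∈ Matrix.unitaryGroup n ℂ := V₄.2.1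
    rw [CStarRing.norm_mul_mem_unitary _ (Unitary.star_mem hV), CStarRing.norm_mem_unitary_mul _ hV]
  have r₄ : ‖(P₀ : Matrix n n ℂ) * ((W₄ : Matrix n n ℂ) - 1) * star (P₀ : Matrix n n ℂ) - ((W₄ : Matrix n n ℂ) - 1)‖
      ≤ 2 * ‖(P₀ : Matrix n n ℂ) - 1‖ * ‖(W₄ : Matrix n n ℂ) - 1‖ := norm_conj_sub_self_le' P₀ _
  -- triangle inequality
  have key : ∀ (A L₃ L₃' L₄ L₄' Z : Matrix n n ℂ),
      ‖A - (Z - L₃' - L₄')‖ ≤ ‖A - (Z - L₃ - L₄)‖ + ‖L₃ - L₃'‖ + ‖L₄ - L₄'‖ := by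
    intro A L₃ L₃' L₄ L₄' Z
    have e : A - (Z - L₃' - L₄') = (A - (Z - L₃ - L₄)) - (L₃ - L₃') - (L₄ - L₄') := by abel
    rw [e]
    exact (norm_sub_le _ _).trans (add_le_add (norm_sub_le _ _) le_rfl)
  have := key ((((W₁ * V₁) * (W₂ * V₂) * (W₃ * V₃)⁻¹ * (W₄ * V₄)⁻¹ : Matrix.specialUnitaryGroup n ℂ) : Matrix n n ℂ) * star (P₀ : Matrix n n ℂ) - 1)
    (((V₁ * V₂ * V₃⁻¹ : Matrix.specialUnitaryGroup n ℂ) : Matrix n n ℂ) * ((W₃ : Matrix n n ℂ) - 1) * star ((V₁ * V₂ * V₃⁻¹ : Matrix.specialUnitaryGroup n ℂ) : Matrix n n ℂ))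
    ((V₄ : Matrix n n ℂ) * ((W₃ : Matrix n n ℂ) - 1) * star (V₄ : Matrix n n ℂ))
    ((P₀ : Matrix n n ℂ) * ((W₄ : Matrix n n ℂ) - 1) * star (P₀ : Matrix n n ℂ)) ((W₄ : Matrix n n ℂ) - 1)
    (((W₁ : Matrix n n ℂ) - 1) + (V₁ : Matrix n n ℂ) * ((W₂ : Matrix n n ℂ) - 1) * star (V₁ : Matrix n n ℂ))
  have hs₃ : 0 ≤ ‖(W₃ : Matrix n n ℂ) - 1‖ := norm_nonneg _
  have hs₄ : 0 ≤ ‖(W₄ : Matrix n n ℂ) - 1‖ := norm_nonneg _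
  have hP : 0 ≤ ‖(P₀ : Matrix n n ℂ) - 1‖ := norm_nonneg _
  linarith [hmain, r₃, r₄, this]

end Algebra


/-! ## §2 On the lattice: the plaquette of `U` against the background plaquette of `U₀`, and the dictionary with the covariant curl (3.4) -/

section Lattice

variable {P : Params} {j : ℕ} {N : ℕ} [NeZero N]

/-- The plaquette variable of `Setup` is the group word `U(b₁)U(b₂)U(b₃)⁻¹U(b₄)⁻¹`. [cite: Balaban1985Averaging, (9) p.19] -/
theorem plaqHol_eq_word (U : GaugeField P j (Matrix.specialUnitaryGroup (Fin N) ℂ)) (p : Plaq P j) :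
    GaugeField.plaqHol U p = U ⟨p.src, p.μ⟩ * U ⟨p.src.shift p.μ, p.ν⟩ * (U ⟨p.src.shift p.ν, p.μ⟩)⁻¹ * (U ⟨p.src, p.ν⟩)⁻¹ := rfl

omit [NeZero N] in
/-- The fluctuation `W(b) = U(b)U₀(b)⁻¹` read in `M_N(ℂ)`: `W(b) − 1 = U(b)U₀(b)^* − 1`. [cite: Balaban1985BackgroundPropagators, (3.1) p.390] -/
theorem coe_mul_inv_sub_one (g h : Matrix.specialUnitaryGroup (Fin N) ℂ) :
    ((g * h⁻¹ : Matrix.specialUnitaryGroup (Fin N) ℂ) : Matrix (Fin N) (Fin N) ℂ) - 1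
      = (g : Matrix (Fin N) (Fin N) ℂ) * star (h : Matrix (Fin N) (Fin N) ℂ) - 1 := rfl

/-- **[Balaban1985Variational] SECT. B AT A BACKGROUND ON THE LATTICE, PER PLAQUETTE**: for `SU(N)` configurations `U` (the competitor) and `U₀` (the background)
with fluctuation `Y(b) = U(b)U₀(b)^* − 1` of norm `≤ 1` on the bonds `b₁ = ⟨x, μ⟩`, `b₃ = ⟨x+e_ν, μ⟩` of `p = p_{μν}(x)`:
`‖U(∂p)U₀(∂p)^* − 1 − (Y(b₁) + U₀(b₁)Y(b₂)U₀(b₁)^* − U₀(b₄)Y(b₃)U₀(b₄)^* − Y(b₄))‖ ≤ 2(Σ_{b∈∂p}‖Y(b)‖)² + 2‖U₀(∂p) − 1‖(‖Y(b₃)‖ + ‖Y(b₄)‖)`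
— the plaquette of `U` relative to the background plaquette is `1 +` the COVARIANT CURL `(D_{U₀}Y)(p)` up to second order in `Y` and a curvature × `Y` term.
[cite: Balaban1985Variational, (22)-(26) pp.281-282; Balaban1985BackgroundPropagators, (3.4) p.391] -/
theorem norm_plaqHol_mul_star_bg_sub_one_sub_covCurl_le (U U₀ : GaugeField P j (Matrix.specialUnitaryGroup (Fin N) ℂ)) (p : Plaq P j)
    (h₁ : ‖(U ⟨p.src, p.μ⟩ : Matrix (Fin N) (Fin N) ℂ) * star (U₀ ⟨p.src, p.μ⟩ : Matrix (Fin N) (Fin N) ℂ) - 1‖ ≤ 1)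
    (h₃ : ‖(U ⟨p.src.shift p.ν, p.μ⟩ : Matrix (Fin N) (Fin N) ℂ) * star (U₀ ⟨p.src.shift p.ν, p.μ⟩ : Matrix (Fin N) (Fin N) ℂ) - 1‖ ≤ 1) :
    ‖((GaugeField.plaqHol U p : Matrix.specialUnitaryGroup (Fin N) ℂ) : Matrix (Fin N) (Fin N) ℂ)
          * star ((GaugeField.plaqHol U₀ p : Matrix.specialUnitaryGroup (Fin N) ℂ) : Matrix (Fin N) (Fin N) ℂ) - 1
        - (((U ⟨p.src, p.μ⟩ : Matrix (Fin N) (Fin N) ℂ) * star (U₀ ⟨p.src, p.μ⟩ : Matrix (Fin N) (Fin N) ℂ) - 1)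
            + (U₀ ⟨p.src, p.μ⟩ : Matrix (Fin N) (Fin N) ℂ)
                * ((U ⟨p.src.shift p.μ, p.ν⟩ : Matrix (Fin N) (Fin N) ℂ) * star (U₀ ⟨p.src.shift p.μ, p.ν⟩ : Matrix (Fin N) (Fin N) ℂ) - 1)
                * star (U₀ ⟨p.src, p.μ⟩ : Matrix (Fin N) (Fin N) ℂ)
            - (U₀ ⟨p.src, p.ν⟩ : Matrix (Fin N) (Fin N) ℂ)
                * ((U ⟨p.src.shift p.ν, p.μ⟩ : Matrix (Fin N) (Fin N) ℂ) * star (U₀ ⟨p.src.shift p.ν, p.μ⟩ : Matrix (Fin N) (Fin N) ℂ) - 1)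
                * star (U₀ ⟨p.src, p.ν⟩ : Matrix (Fin N) (Fin N) ℂ)
            - ((U ⟨p.src, p.ν⟩ : Matrix (Fin N) (Fin N) ℂ) * star (U₀ ⟨p.src, p.ν⟩ : Matrix (Fin N) (Fin N) ℂ) - 1))‖
      ≤ 2 * (‖(U ⟨p.src, p.μ⟩ : Matrix (Fin N) (Fin N) ℂ) * star (U₀ ⟨p.src, p.μ⟩ : Matrix (Fin N) (Fin N) ℂ) - 1‖
              + ‖(U ⟨p.src.shift p.μ, p.ν⟩ : Matrix (Fin N) (Fin N) ℂ) * star (U₀ ⟨p.src.shift p.μ, p.ν⟩ : Matrix (Fin N) (Fin N) ℂ) - 1‖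
              + ‖(U ⟨p.src.shift p.ν, p.μ⟩ : Matrix (Fin N) (Fin N) ℂ) * star (U₀ ⟨p.src.shift p.ν, p.μ⟩ : Matrix (Fin N) (Fin N) ℂ) - 1‖
              + ‖(U ⟨p.src, p.ν⟩ : Matrix (Fin N) (Fin N) ℂ) * star (U₀ ⟨p.src, p.ν⟩ : Matrix (Fin N) (Fin N) ℂ) - 1‖) ^ 2
        + 2 * ‖((GaugeField.plaqHol U₀ p : Matrix.specialUnitaryGroup (Fin N) ℂ) : Matrix (Fin N) (Fin N) ℂ) - 1‖
            * (‖(U ⟨p.src.shift p.ν, p.μ⟩ : Matrix (Fin N) (Fin N) ℂ) * star (U₀ ⟨p.src.shift p.ν, p.μ⟩ : Matrix (Fin N) (Fin N) ℂ) - 1‖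
              + ‖(U ⟨p.src, p.ν⟩ : Matrix (Fin N) (Fin N) ℂ) * star (U₀ ⟨p.src, p.ν⟩ : Matrix (Fin N) (Fin N) ℂ) - 1‖) := by
  -- the fluctuations `W_i = U_i U₀_i⁻¹`
  set W₁ := U ⟨p.src, p.μ⟩ * (U₀ ⟨p.src, p.μ⟩)⁻¹ with hW₁
  set W₂ := U ⟨p.src.shift p.μ, p.ν⟩ * (U₀ ⟨p.src.shift p.μ, p.ν⟩)⁻¹ with hW₂
  set W₃ := U ⟨p.src.shift p.ν, p.μ⟩ * (U₀ ⟨p.src.shift p.ν, p.μ⟩)⁻¹ with hW₃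
  set W₄ := U ⟨p.src, p.ν⟩ * (U₀ ⟨p.src, p.ν⟩)⁻¹ with hW₄
  have hU : GaugeField.plaqHol U p
      = (W₁ * U₀ ⟨p.src, p.μ⟩) * (W₂ * U₀ ⟨p.src.shift p.μ, p.ν⟩) * (W₃ * U₀ ⟨p.src.shift p.ν, p.μ⟩)⁻¹ * (W₄ * U₀ ⟨p.src, p.ν⟩)⁻¹ := by
    rw [plaqHol_eq_word, hW₁, hW₂, hW₃, hW₄]
    simp only [inv_mul_cancel_right]
  have hU₀ : GaugeField.plaqHol U₀ p
      = U₀ ⟨p.src, p.μ⟩ * U₀ ⟨p.src.shift p.μ, p.ν⟩ * (U₀ ⟨p.src.shift p.ν, p.μ⟩)⁻¹ * (U₀ ⟨p.src, p.ν⟩)⁻¹ := plaqHol_eq_word U₀ p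
  have e₁ : (U ⟨p.src, p.μ⟩ : Matrix (Fin N) (Fin N) ℂ) * star (U₀ ⟨p.src, p.μ⟩ : Matrix (Fin N) (Fin N) ℂ) - 1 = (W₁ : Matrix (Fin N) (Fin N) ℂ) - 1 :=
    (coe_mul_inv_sub_one _ _).symm
  have e₂ : (U ⟨p.src.shift p.μ, p.ν⟩ : Matrix (Fin N) (Fin N) ℂ) * star (U₀ ⟨p.src.shift p.μ, p.ν⟩ : Matrix (Fin N) (Fin N) ℂ) - 1
      = (W₂ : Matrix (Fin N) (Fin N) ℂ) - 1 := (coe_mul_inv_sub_one _ _).symm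
  have e₃ : (U ⟨p.src.shift p.ν, p.μ⟩ : Matrix (Fin N) (Fin N) ℂ) * star (U₀ ⟨p.src.shift p.ν, p.μ⟩ : Matrix (Fin N) (Fin N) ℂ) - 1
      = (W₃ : Matrix (Fin N) (Fin N) ℂ) - 1 := (coe_mul_inv_sub_one _ _).symm
  have e₄ : (U ⟨p.src, p.ν⟩ : Matrix (Fin N) (Fin N) ℂ) * star (U₀ ⟨p.src, p.ν⟩ : Matrix (Fin N) (Fin N) ℂ) - 1 = (W₄ : Matrix (Fin N) (Fin N) ℂ) - 1 :=
    (coe_mul_inv_sub_one _ _).symm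
  rw [hU, hU₀, e₁, e₂, e₃, e₄]
  rw [e₁] at h₁
  rw [e₃] at h₃
  exact norm_plaq_mul_star_bg_sub_one_sub_curl_le W₁ W₂ W₃ W₄ _ _ _ _ h₁ h₃

omit [NeZero N] in
/-- **DICTIONARY WITH [B9] (3.4)**: the linear term above IS the covariant curl `(D_{U₀}Y)(p_{μν}(x)) = (D_{U₀,μ}Y_ν)(x) − (D_{U₀,ν}Y_μ)(x)` of the tree's
`B9Eq39Adjoint.curl` at the background `(κ, z) ↦ U₀(z, z+e_κ)` (read in the units of `M_N(ℂ)` through `unitsField ∘ toUField`, `R(u)X = uXu⁻¹ = uXu^*`).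
[cite: Balaban1985BackgroundPropagators, (3.3)-(3.4) pp.390-391] -/
theorem curl_bg_eq (U₀ : GaugeField P j (Matrix.specialUnitaryGroup (Fin N) ℂ)) (Y : PBond P j → Matrix (Fin N) (Fin N) ℂ) (p : Plaq P j) :
    curl (torusT P j) (fun κ z => unitsField (toUField U₀) ⟨z, κ⟩) (fun κ z => Y ⟨z, κ⟩) p.μ p.ν p.src
      = Y ⟨p.src, p.μ⟩ + (U₀ ⟨p.src, p.μ⟩ : Matrix (Fin N) (Fin N) ℂ) * Y ⟨p.src.shift p.μ, p.ν⟩ * star (U₀ ⟨p.src, p.μ⟩ : Matrix (Fin N) (Fin N) ℂ)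
        - (U₀ ⟨p.src, p.ν⟩ : Matrix (Fin N) (Fin N) ℂ) * Y ⟨p.src.shift p.ν, p.μ⟩ * star (U₀ ⟨p.src, p.ν⟩ : Matrix (Fin N) (Fin N) ℂ)
        - Y ⟨p.src, p.ν⟩ := by
  have hu : ∀ b : PBond P j, ((unitsField (toUField U₀) b : (Matrix (Fin N) (Fin N) ℂ)ˣ) : Matrix (Fin N) (Fin N) ℂ) = (U₀ b : Matrix (Fin N) (Fin N) ℂ) :=
    fun b => rfl
  have hui : ∀ b : PBond P j, (((unitsField (toUField U₀) b)⁻¹ : (Matrix (Fin N) (Fin N) ℂ)ˣ) : Matrix (Fin N) (Fin N) ℂ) = star (U₀ b : Matrix (Fin N) (Fin N) ℂ) := by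
    intro b
    rw [coe_inv_eq_star (B7Prop2Explicit.mem_unitaryUnits.mp (unitsField_mem_unitaryUnits (toUField U₀) b)), hu]
  simp only [curl, covD, R_def, torusT_apply, hu, hui]
  abel

end Lattice

end Summit.QuantumFields.YangMills.Theorems.Prop7CovariantCoercivity

end
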